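import Summits.QuantumFields.YangMills.Theorems.BalabanUVNodesN19TargetAtHomes12
import Summits.QuantumFields.YangMills.Theorems.BalabanUVNodesN19TargetAtHomes12On
import Summits.QuantumFields.YangMills.Theorems.BalabanUVNodesN19TargetAtHomes12OnVacuumMGF
import Summits.QuantumFields.YangMills.Theses.BalabanUVNodes

/-!
# BalabanUVNodes ∕ N19 (NE7 proper) — the route item K3′ `SpineGivenEndpointR12` (stmt-QuantumFields-19792) READ IN N19's CURRENCY: node U5's DECL target
# `T4ApexVariance.MatchingUnder` at every guarded admissible Stage-12 datum of record (`N = 2`)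

Cell `pub-ymgap` (HUMAN RULING D-0062, Track A), R134 ACCELERATION seat `pub-ymgap-dag-n19-d` (strategy s2), gen 3, module 9 = the ₁₂ twin of module 2 §3
(`…N19TargetAtRecord11Currency`, `spineGivenEndpointR11_iff_matchingUnder_at_record₁₁`).  This file imports the route file BECAUSE its theorems carry the route decl
`Summit.QuantumFields.YangMills.Theses.BalabanUVNodes.SpineGivenEndpointR12` in their TYPE (director LINE №103 (1) rule); everything else of the N19 knit lives in the
restate-immune modules 6a∕6b∕7∕8.  Filed `--supports stmt-QuantumFields-19792` (K3′; dag-lead WORDS-108 key table).  COUNT-NEUTRAL; K3′ is NOT claimed.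

WHAT IS KERNEL-CHECKED ([bookkeeping], 0 `def`, 0 `sorry`).  K3′'s text (route rev 15, 20:35:43Z: plan g64's rev 13∕14 text with the 1:1 restate threading `θ.SlotsNondegenerate`, director LINES №99 (2) form (i) ∕ №108 ∕
№109): «for every family, every Stage-12 tuple `θ` with provisos `h`, `(θ.ZtUnity F 2 ∧ θ.SlotsNondegenerate) → θ.Admissible F 2 → (B) at the datum → END at the
datum → T4ApexHybrid.HybridNE7Under (datumOfRecord₁₂ F 2 θ h) END».  Since `HybridNE7Under D END` is ITSELF `(B) → END → ForSmallCouplings D (StringwiseHybridNE7 ∘ D.scheme)` (`FiniteEpsData.UnderHypotheses`, definitional), the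
displayed `(B) → END →` prefix is B5-under-END's own, and by the degenerate expansion at the datum (module 7 `hybridNE7Under_datumOfRecord₁₂_iff_matchingUnder`, B1 at the
datum) the item IS «`MatchingUnder (datumOfRecord₁₂ F 2 θ h) END` at every guarded (partition of unity ∧ non-degenerate present slots) admissible Stage-12 tuple with
provisos» — N19's DECL target
`T4CauchySum.MatchingModConstants vol l₀ δ Z ∧ Summable δ` string-wise under the prefix, at the repaired record's data:
* `spineGivenEndpointR12_iff_forall_guarded_matchingUnder` (the reading) · `matchingUnder_datumOfRecord₁₂_of_spineGivenEndpointR12` (→) ·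
  `spineGivenEndpointR12_of_forall_guarded_matchingUnder` (←) · `spineGivenEndpointR12_of_forall_record₁₂_matchingUnder` (N19's target at every ₁₂C record — the
  conclusion shape of module 7's `matchingUnder_at_record₁₂_of_*` closers at `N = 2` — gives K3′; the guard only weakens) ·
  `spineGivenEndpointR12_of_rateStubs_at_homes₁₂` (the N19 road to K3′ AT THE TWO STAGE-12 HOMES: the six in-edges BY NAME at `RRec₁₂ 𝔯`, the spine stubs at the
  canonical spine home `SRec₁₂ (canonReading₁₂ cr)`, the SAME-KEY N19′ edge — module 8's `matchingUnder_at_homes₁₂_of_rateStubs` at `N = 2`).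

v1.1 (APPEND-ONLY, gen 4; +1 import module 10 `…N19TargetAtHomes12On`, +2 theorems, the decls above byte-identical; filed `--supports` K3′ = stmt-QuantumFields-19908, the rev-15
restate's NEW id — dag-lead WORDS-111 ∕ director LINE №113).  §2 THE ITEM FROM THE STUBS AT THE GUARD-RESTRICTED STAGE-12 HOMES AND A SOURCE-SPLIT READING: at the regime
`Rg F θ := θ.ZtUnity F 2 ∧ θ.SlotsNondegenerate` — the item's own guard, so the guard REACHES every hypothesis — the six in-edges BY NAME at the tuple-keyed rate home
`RRec₁₂On 𝔯 Rg` (dag-n22-e), `S_N20` ∕ `S_N21` at `SRec₁₂On cr Rg` (dag-n20-d), the guarded keyed extraction clause, and a SOURCE-SPLIT reading of `cr` at the guarded tuples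
(dag-n19-e's located FIRST MISSING ESTIMATE of N19: (V) class-uniform vacuum matching + (I) per-class source-response matching of the two runs, summable — or (V) + agreement of
the tilted insertion means) ⇒ `SpineGivenEndpointR12` (`spineGivenEndpointR12_of_homes₁₂On_sourceSplit ∕ _insertionDeriv`: module 10's
`matchingUnder_guarded_datumOfRecord₁₂_of_homes₁₂On(_sourceSplit)` ∘ `spineGivenEndpointR12_of_forall_guarded_matchingUnder`).  dag-n27-c's XXVI `spineGivenEndpointR12_of_homes₁₂On`
takes the N19′ EDGE at the guarded homes; these take the READING that produces it.  Every stub and the reading a HYPOTHESIS (0∕1 today).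

HONEST FRAMING.  A READING of the route item, not a proof of it: every theorem is an equivalence or takes N19's target as a HYPOTHESIS; nothing of Bałaban's is asserted;
NE7 ∕ NE7b ∕ NE7c NOT PRINTED for d = 4, NOT PROVED; N19 NOT discharged; K3′ OPEN and NOT claimed; whether a unity-guarded admissible Stage-12 tuple exists is K0′
(stmt-QuantumFields-19789); counts UNMOVED (typed 28∕28 · discharged 5∕27, A 5∕28); one finite four-torus programme at fixed `ε = L^{−K}` — NOT ℝ⁴, NOT infinite volume,
NOT OS, NOT a mass gap, NOT Clay.  No cite tags (bookkeeping [folklore]).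

v1.2 (APPEND-ONLY; §1–§2's seven decls byte-identical; one import added) — §3 THE ITEM FROM THE STUBS AT THE GUARD-HOMES AND A VACUUM-CORE ∕ MGF ∕ TILTED-MATCHING
READING (lens «decomp» v4 road (ii), this seat's modules 14 `N19VacuumMGFRoad` (ROW VL) and 15 `N19TargetAtHomes12OnVacuumMGF`): §2's pattern with the SOURCE-SPLIT reading REPLACED by
(a) `spineGivenEndpointR12_of_homes₁₂On_vacuumMGF` — the VACUUM shell-free cores' `NE7.Core` with summable `δ⁰`, MGF forms of both dressed shell-free cores, N14's
`TiltedMeanMatching η` with `Summable η`; (b) `spineGivenEndpointR12_of_homes₁₂On_vacuumLedgerPiecesMGF` — the vacuum `Core` itself PRODUCED by the ledger road at the pieces of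
record (F1 · F2 · F3 · S · C of `N19LedgerPieces` on the vacuum cores + species data in place of F3′ + the in-edge letters).  On this road the «(V)+(I) producer» of §2 is NOT an
N19 estimate: (I) = N14's NE1′ residual by name, (V) = bookkeeping over the in-edges; the observable meets N19 only through `η`.  K3′ is NOT claimed — every antecedent is a
HYPOTHESIS; count-neutral.
-/

namespace Summit.QuantumFields.YangMills.BalabanUVNodes.N19TargetK3R12Reading

open Literature.MathematicalPhysics.QuantumFieldTheory.Balaban1983to89
open Literature.MathematicalPhysics.QuantumFieldTheory.Balaban1983to89.T4Continuum
open T4ApexVariance (MatchingUnder)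
open Summit.QuantumFields.BalabanUV.T4Continuum.Spine
open Summit.QuantumFields.YangMills.Theses.BalabanUVNodes (SpineGivenEndpointR12)
open Summit.QuantumFields.YangMills.BalabanUVNodes.N19TargetAtRecord12 (hybridNE7Under_datumOfRecord₁₂_iff_matchingUnder
  forall_record₁₂_matchingUnder_iff_forall_datumOfRecord₁₂)
open Summit.QuantumFields.YangMills.BalabanUVNodes.N19TargetAtHomes12 (matchingUnder_at_homes₁₂_of_rateStubs)
open YMDAG.UVSplit
open Node00 (Stage12Params datumOfRecord₁₂ IsRecordOfRecord₁₂C)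

/-- **K3′ ⟹ N19's TARGET AT EVERY GUARDED ADMISSIBLE STAGE-12 DATUM** [bookkeeping]: from `SpineGivenEndpointR12`, at every `θ` with provisos `h`, the guard
`θ.ZtUnity F 2 ∧ θ.SlotsNondegenerate` and `θ.Admissible F 2`: `MatchingUnder (datumOfRecord₁₂ F 2 θ h) END` (the item's displayed `(B) → END →` prefix is fed B5-under-END's own antecedents; then the
degenerate expansion at the datum). [folklore] -/
theorem matchingUnder_datumOfRecord₁₂_of_spineGivenEndpointR12 (hK : SpineGivenEndpointR12) (F : T4Family) (θ : Stage12Params F 2) (h : θ.Provisos₁₂ F 2)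
    (hG : θ.ZtUnity F 2 ∧ θ.SlotsNondegenerate) (hθ : θ.Admissible F 2) :
    MatchingUnder (datumOfRecord₁₂ F 2 θ h) (DagBinding.EndpointExistence (datumOfRecord₁₂ F 2 θ h).C.toB12) :=
  (hybridNE7Under_datumOfRecord₁₂_iff_matchingUnder θ h _).mp fun hB hE => hK F θ h hG hθ hB hE hB hE

/-- **N19's TARGET AT EVERY GUARDED ADMISSIBLE STAGE-12 DATUM ⟹ K3′** [bookkeeping] (the displayed (B)∕END hypotheses are discarded — B5 under END carries
its own). [folklore] -/
theorem spineGivenEndpointR12_of_forall_guarded_matchingUnder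
    (h : ∀ (F : T4Family) (θ : Stage12Params F 2) (hP : θ.Provisos₁₂ F 2), θ.ZtUnity F 2 ∧ θ.SlotsNondegenerate → θ.Admissible F 2 →
      MatchingUnder (datumOfRecord₁₂ F 2 θ hP) (DagBinding.EndpointExistence (datumOfRecord₁₂ F 2 θ hP).C.toB12)) :
    SpineGivenEndpointR12 :=
  fun F θ hP hG hθ _ _ => (hybridNE7Under_datumOfRecord₁₂_iff_matchingUnder θ hP _).mpr (h F θ hP hG hθ)

/-- **THE READING: K3′ `SpineGivenEndpointR12` ⟺ N19's DECL TARGET AT EVERY GUARDED ADMISSIBLE STAGE-12 DATUM OF RECORD** [bookkeeping] — at `N = 2`, for every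
family, every Stage-12 tuple `θ` with provisos, print's partition of unity and non-degenerate present slots (`θ.ZtUnity F 2 ∧ θ.SlotsNondegenerate`), admissible: `T4ApexVariance.MatchingUnder (Node00.datumOfRecord₁₂ F 2 θ h) END`
(for all small-coupling tuned runs and every loop string, the dressed partition functions match modulo `t`-independent constants with a summable remainder).  Module 7's
`forall_guarded_matchingUnder_datumOfRecord₁₂_iff` at the guard `G θ := θ.ZtUnity F 2 ∧ θ.SlotsNondegenerate`, the item's (B)∕END prefix absorbed. [folklore] -/
theorem spineGivenEndpointR12_iff_forall_guarded_matchingUnder :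
    SpineGivenEndpointR12 ↔ ∀ (F : T4Family) (θ : Stage12Params F 2) (h : θ.Provisos₁₂ F 2), θ.ZtUnity F 2 ∧ θ.SlotsNondegenerate → θ.Admissible F 2 →
      MatchingUnder (datumOfRecord₁₂ F 2 θ h) (DagBinding.EndpointExistence (datumOfRecord₁₂ F 2 θ h).C.toB12) :=
  ⟨matchingUnder_datumOfRecord₁₂_of_spineGivenEndpointR12, spineGivenEndpointR12_of_forall_guarded_matchingUnder⟩

/-- **N19's TARGET AT EVERY STAGE-12 RECORD GIVES K3′** [bookkeeping]: «`MatchingUnder D END` at every `Node00.IsRecordOfRecord₁₂C F 2 D w`» — the conclusion shape of module 7's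
closers `matchingUnder_at_record₁₂_of_spineRates ∕ _of_rateStubs(_tail) ∕ _of_termBudgetReading ∕ _of_keyedFaces ∕ …` at `N = 2` — implies `SpineGivenEndpointR12`
(worlds eliminated by (K2), module 7 `forall_record₁₂_matchingUnder_iff_forall_datumOfRecord₁₂`; the guard only weakens). [folklore] -/
theorem spineGivenEndpointR12_of_forall_record₁₂_matchingUnder
    (h : ∀ (F : T4Family) (D : Datum F 2) (w : DagBinding.WorldP), IsRecordOfRecord₁₂C F 2 D w → MatchingUnder D (DagBinding.EndpointExistence D.C.toB12)) :
    SpineGivenEndpointR12 :=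
  spineGivenEndpointR12_of_forall_guarded_matchingUnder fun F θ hP _ hθ => forall_record₁₂_matchingUnder_iff_forall_datumOfRecord₁₂.mp h F θ hP hθ

/-- **THE N19 ROAD TO K3′ AT THE TWO STAGE-12 HOMES** [bookkeeping]: for residual readings `cr` (spine carriers) and `𝔯` (rate carriers) at `N = 2` — the six in-edges BY NAME
at the (T-RATE) home `RRec₁₂ 𝔯` (`S_N14` · `S_N15` · `S_N16` · `S_N17` · `S_N18` · `S_N22`; K4's existence stub is n22-e's theorem `s_R00x_rRec₁₂`), the spine stubs
`S_N27x ₁₂C` · `S_N20` · `S_N21` at the CANONICAL spine home `SRec₁₂ (canonReading₁₂ cr)`, and the SAME-KEY N19′ edge «`RatesAt D (rateCarriersOfRecord₁₂ 𝔯 F h.params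
h.provisos g₀ os k) → ∃ δ, Spine.NE7.Core (cores of cr F h.params h.provisos g₀ os) δ ∧ Summable δ`» at every Stage-12 datum key ⇒ `SpineGivenEndpointR12` (module 8's
`matchingUnder_at_homes₁₂_of_rateStubs`, then `spineGivenEndpointR12_of_forall_record₁₂_matchingUnder`).  Every stub and the edge a HYPOTHESIS; nothing produced. [folklore] -/
theorem spineGivenEndpointR12_of_rateStubs_at_homes₁₂ (cr : SpineReading₁₂ 2) (𝔯 : RateReading₁₂ 2)
    (h14 : S_N14 (RRec₁₂ 𝔯)) (h15 : S_N15 (RRec₁₂ 𝔯)) (h16 : S_N16 (RRec₁₂ 𝔯)) (h17 : S_N17 (RRec₁₂ 𝔯)) (h18 : S_N18 (RRec₁₂ 𝔯)) (h22 : S_N22 (RRec₁₂ 𝔯))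
    (hx : S_N27x (fun F D w => IsRecordOfRecord₁₂C F 2 D w) (SRec₁₂ (canonReading₁₂ cr))) (h20 : S_N20 (SRec₁₂ (canonReading₁₂ cr)))
    (h21 : S_N21 (SRec₁₂ (canonReading₁₂ cr)))
    (h19 : ∀ (F : T4Family) (D : Datum F 2) (h : Node00.IsDatumOfRecord₁₂C F 2 D) (g₀ : ℕ → ℝ) (os : List (ULoop F)) (k : ℕ),
      RatesAt D (rateCarriersOfRecord₁₂ 𝔯 F h.params h.provisos g₀ os k) → letI := (cr F h.params h.provisos g₀ os).dec
      ∃ δ : ℕ → ℝ, NE7.Core (cr F h.params h.provisos g₀ os).l₀ (cr F h.params h.provisos g₀ os).vol (cr F h.params h.provisos g₀ os).T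
        (cr F h.params h.provisos g₀ os).Bad
        (fun K t τ => (cr F h.params h.provisos g₀ os).A K t τ - (cr F h.params h.provisos g₀ os).shA K t τ)
        (fun K t τ => (cr F h.params h.provisos g₀ os).B K t τ - (cr F h.params h.provisos g₀ os).shB K t τ) δ ∧ Summable δ) :
    SpineGivenEndpointR12 :=
  spineGivenEndpointR12_of_forall_record₁₂_matchingUnder fun _ _ _ hR => matchingUnder_at_homes₁₂_of_rateStubs cr 𝔯 h14 h15 h16 h17 h18 h22 hx h20 h21 h19 hR

/-! ## §2 (v1.1, append-only) The item from the stubs at the GUARD-restricted Stage-12 homes and a SOURCE-SPLIT reading (module 10 by name) -/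

section GuardHomes

open Summit.QuantumFields.YangMills.BalabanUVNodes.N19TargetAtHomes12On (matchingUnder_guarded_datumOfRecord₁₂_of_homes₁₂On
  matchingUnder_guarded_datumOfRecord₁₂_of_homes₁₂On_sourceSplit towerEdge₁₂On_of_insertionDerivReading)

variable (cr : SpineReading₁₂ 2) (𝔯 : RateReading₁₂ 2)

/-- **K3′ FROM THE STUBS AT THE GUARD-RESTRICTED STAGE-12 HOMES AND A SOURCE-SPLIT READING** [bookkeeping] (`N = 2`, regime = the item's guard
`θ.ZtUnity F 2 ∧ θ.SlotsNondegenerate`): the six in-edges BY NAME at `RRec₁₂On 𝔯 Rg` (`S_N14` · `S_N15` · `S_N16` · `S_N17` · `S_N18` · `S_N22`, each its node's estimate asked ONLY of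
guarded admissible tuples, read at θ), `S_N20` ∕ `S_N21` at `SRec₁₂On cr Rg`, the guarded keyed extraction clause (positivity + E1∕E2 under (B), END, small tuned couplings), and a
SOURCE-SPLIT reading of `cr` at the guarded tuples — given the rates at every run length of `𝔯`: positive shell-free cores on the good classes, (V) a class-uniform VACUUM matching and
(I) a per-class SOURCE-RESPONSE matching of `log (B − shB) − log (A − shA)` with summable `δ⁰`, `δ¹` — ⇒ `SpineGivenEndpointR12` (module 10
`matchingUnder_guarded_datumOfRecord₁₂_of_homes₁₂On_sourceSplit` ∘ `spineGivenEndpointR12_of_forall_guarded_matchingUnder`).  Every input a HYPOTHESIS; (V)∕(I) NOT PRINTED. [folklore] -/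
theorem spineGivenEndpointR12_of_homes₁₂On_sourceSplit
    (h14 : S_N14 (RRec₁₂On 𝔯 fun F θ => θ.ZtUnity F 2 ∧ θ.SlotsNondegenerate)) (h15 : S_N15 (RRec₁₂On 𝔯 fun F θ => θ.ZtUnity F 2 ∧ θ.SlotsNondegenerate))
    (h16 : S_N16 (RRec₁₂On 𝔯 fun F θ => θ.ZtUnity F 2 ∧ θ.SlotsNondegenerate)) (h17 : S_N17 (RRec₁₂On 𝔯 fun F θ => θ.ZtUnity F 2 ∧ θ.SlotsNondegenerate))
    (h18 : S_N18 (RRec₁₂On 𝔯 fun F θ => θ.ZtUnity F 2 ∧ θ.SlotsNondegenerate)) (h22 : S_N22 (RRec₁₂On 𝔯 fun F θ => θ.ZtUnity F 2 ∧ θ.SlotsNondegenerate))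
    (h20 : S_N20 (SRec₁₂On cr fun F θ => θ.ZtUnity F 2 ∧ θ.SlotsNondegenerate)) (h21 : S_N21 (SRec₁₂On cr fun F θ => θ.ZtUnity F 2 ∧ θ.SlotsNondegenerate))
    (hx : ∀ (F : T4Family) (θ : Stage12Params F 2) (hP : θ.Provisos₁₂ F 2), θ.ZtUnity F 2 ∧ θ.SlotsNondegenerate → θ.Admissible F 2 →
      B16.EndStatementBPrinted (datumOfRecord₁₂ F 2 θ hP).C → DagBinding.EndpointExistence (datumOfRecord₁₂ F 2 θ hP).C.toB12 →
        T4ContinuumYM4Torus.ForSmallCouplings (datumOfRecord₁₂ F 2 θ hP) fun g₀ => ∀ os : List (ULoop F),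
          0 < (cr F θ hP g₀ os).l₀ ∧ 0 < (cr F θ hP g₀ os).vol ∧
          (∀ (K : ℕ) (t : ℝ), |t| ≤ (cr F θ hP g₀ os).l₀ →
            T4GenFunBounds.schemeZ ((datumOfRecord₁₂ F 2 θ hP).scheme g₀) os ((cr F θ hP g₀ os).K₀ + K) t =
              ∑ τ ∈ (cr F θ hP g₀ os).T K, (cr F θ hP g₀ os).A K t τ) ∧
          (∀ (K : ℕ) (t : ℝ), |t| ≤ (cr F θ hP g₀ os).l₀ →
            T4GenFunBounds.schemeZ ((datumOfRecord₁₂ F 2 θ hP).scheme g₀) os ((cr F θ hP g₀ os).K₀ + K + 1) t =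
              ∑ τ ∈ (cr F θ hP g₀ os).T K, (cr F θ hP g₀ os).B K t τ))
    (hread : ∀ (F : T4Family) (θ : Stage12Params F 2) (hP : θ.Provisos₁₂ F 2), θ.ZtUnity F 2 ∧ θ.SlotsNondegenerate → θ.Admissible F 2 →
      ∀ (g₀ : ℕ → ℝ) (os : List (ULoop F)),
      (∀ k : ℕ, RatesAt (datumOfRecord₁₂ F 2 θ hP) (rateCarriersOfRecord₁₂ 𝔯 F θ hP g₀ os k)) → letI := (cr F θ hP g₀ os).dec
      (∀ K t, |t| ≤ (cr F θ hP g₀ os).l₀ → ∀ τ ∈ (cr F θ hP g₀ os).T K \ (cr F θ hP g₀ os).Bad K t,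
        0 < (cr F θ hP g₀ os).A K t τ - (cr F θ hP g₀ os).shA K t τ ∧ 0 < (cr F θ hP g₀ os).B K t τ - (cr F θ hP g₀ os).shB K t τ) ∧
      ∃ δ₀ δ₁ : ℕ → ℝ, Summable δ₀ ∧ Summable δ₁ ∧
        (∀ K, ∃ c : ℝ, ∀ t : ℝ, |t| ≤ (cr F θ hP g₀ os).l₀ → ∀ τ ∈ (cr F θ hP g₀ os).T K \ (cr F θ hP g₀ os).Bad K t,
          |Real.log ((cr F θ hP g₀ os).B K 0 τ - (cr F θ hP g₀ os).shB K 0 τ) - Real.log ((cr F θ hP g₀ os).A K 0 τ - (cr F θ hP g₀ os).shA K 0 τ) - c| ≤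
            (cr F θ hP g₀ os).vol * δ₀ K) ∧
        (∀ K (t : ℝ), |t| ≤ (cr F θ hP g₀ os).l₀ → ∀ τ ∈ (cr F θ hP g₀ os).T K \ (cr F θ hP g₀ os).Bad K t,
          |(Real.log ((cr F θ hP g₀ os).B K t τ - (cr F θ hP g₀ os).shB K t τ) - Real.log ((cr F θ hP g₀ os).A K t τ - (cr F θ hP g₀ os).shA K t τ)) -
              (Real.log ((cr F θ hP g₀ os).B K 0 τ - (cr F θ hP g₀ os).shB K 0 τ) - Real.log ((cr F θ hP g₀ os).A K 0 τ - (cr F θ hP g₀ os).shA K 0 τ))| ≤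
            (cr F θ hP g₀ os).vol * δ₁ K)) :
    SpineGivenEndpointR12 :=
  spineGivenEndpointR12_of_forall_guarded_matchingUnder fun F θ hP hG hθ =>
    matchingUnder_guarded_datumOfRecord₁₂_of_homes₁₂On_sourceSplit cr 𝔯 (fun F θ => θ.ZtUnity F 2 ∧ θ.SlotsNondegenerate)
      h14 h15 h16 h17 h18 h22 h20 h21 hx hread F θ hP hG hθ

/-- **K3′ FROM THE STUBS AT THE GUARD-RESTRICTED STAGE-12 HOMES AND AN INSERTION-DERIVATIVE READING** [bookkeeping] (`N = 2`; the same with (I) replaced by the agreement of the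
two runs' TILTED INSERTION MEANS: at every guarded admissible tuple, given the rates at every run length, `0 < vol`, positive shell-free cores on the good classes, (V) with summable
`δ⁰`, source-differentiable log-cores on `[−l₀, l₀]` with derivatives `mA`, `mB` and `|mB − mA| ≤ Λ_K` along the source segment of every good class, `0 ≤ Λ` summable ⇒
`SpineGivenEndpointR12`; module 10 `towerEdge₁₂On_of_insertionDerivReading` produces the edge, `matchingUnder_guarded_datumOfRecord₁₂_of_homes₁₂On` consumes it). [folklore] -/
theorem spineGivenEndpointR12_of_homes₁₂On_insertionDeriv
    (h14 : S_N14 (RRec₁₂On 𝔯 fun F θ => θ.ZtUnity F 2 ∧ θ.SlotsNondegenerate)) (h15 : S_N15 (RRec₁₂On 𝔯 fun F θ => θ.ZtUnity F 2 ∧ θ.SlotsNondegenerate))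
    (h16 : S_N16 (RRec₁₂On 𝔯 fun F θ => θ.ZtUnity F 2 ∧ θ.SlotsNondegenerate)) (h17 : S_N17 (RRec₁₂On 𝔯 fun F θ => θ.ZtUnity F 2 ∧ θ.SlotsNondegenerate))
    (h18 : S_N18 (RRec₁₂On 𝔯 fun F θ => θ.ZtUnity F 2 ∧ θ.SlotsNondegenerate)) (h22 : S_N22 (RRec₁₂On 𝔯 fun F θ => θ.ZtUnity F 2 ∧ θ.SlotsNondegenerate))
    (h20 : S_N20 (SRec₁₂On cr fun F θ => θ.ZtUnity F 2 ∧ θ.SlotsNondegenerate)) (h21 : S_N21 (SRec₁₂On cr fun F θ => θ.ZtUnity F 2 ∧ θ.SlotsNondegenerate))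
    (hx : ∀ (F : T4Family) (θ : Stage12Params F 2) (hP : θ.Provisos₁₂ F 2), θ.ZtUnity F 2 ∧ θ.SlotsNondegenerate → θ.Admissible F 2 →
      B16.EndStatementBPrinted (datumOfRecord₁₂ F 2 θ hP).C → DagBinding.EndpointExistence (datumOfRecord₁₂ F 2 θ hP).C.toB12 →
        T4ContinuumYM4Torus.ForSmallCouplings (datumOfRecord₁₂ F 2 θ hP) fun g₀ => ∀ os : List (ULoop F),
          0 < (cr F θ hP g₀ os).l₀ ∧ 0 < (cr F θ hP g₀ os).vol ∧
          (∀ (K : ℕ) (t : ℝ), |t| ≤ (cr F θ hP g₀ os).l₀ →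
            T4GenFunBounds.schemeZ ((datumOfRecord₁₂ F 2 θ hP).scheme g₀) os ((cr F θ hP g₀ os).K₀ + K) t =
              ∑ τ ∈ (cr F θ hP g₀ os).T K, (cr F θ hP g₀ os).A K t τ) ∧
          (∀ (K : ℕ) (t : ℝ), |t| ≤ (cr F θ hP g₀ os).l₀ →
            T4GenFunBounds.schemeZ ((datumOfRecord₁₂ F 2 θ hP).scheme g₀) os ((cr F θ hP g₀ os).K₀ + K + 1) t =
              ∑ τ ∈ (cr F θ hP g₀ os).T K, (cr F θ hP g₀ os).B K t τ))
    (hread : ∀ (F : T4Family) (θ : Stage12Params F 2) (hP : θ.Provisos₁₂ F 2), θ.ZtUnity F 2 ∧ θ.SlotsNondegenerate → θ.Admissible F 2 →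
      ∀ (g₀ : ℕ → ℝ) (os : List (ULoop F)),
      (∀ k : ℕ, RatesAt (datumOfRecord₁₂ F 2 θ hP) (rateCarriersOfRecord₁₂ 𝔯 F θ hP g₀ os k)) → letI := (cr F θ hP g₀ os).dec
      0 < (cr F θ hP g₀ os).vol ∧
      (∀ K t, |t| ≤ (cr F θ hP g₀ os).l₀ → ∀ τ ∈ (cr F θ hP g₀ os).T K \ (cr F θ hP g₀ os).Bad K t,
        0 < (cr F θ hP g₀ os).A K t τ - (cr F θ hP g₀ os).shA K t τ ∧ 0 < (cr F θ hP g₀ os).B K t τ - (cr F θ hP g₀ os).shB K t τ) ∧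
      ∃ (δ₀ Λ : ℕ → ℝ) (mA mB : ℕ → ℝ → (cr F θ hP g₀ os).ι → ℝ), Summable δ₀ ∧ Summable Λ ∧ (∀ K, 0 ≤ Λ K) ∧
        (∀ K, ∃ c : ℝ, ∀ t : ℝ, |t| ≤ (cr F θ hP g₀ os).l₀ → ∀ τ ∈ (cr F θ hP g₀ os).T K \ (cr F θ hP g₀ os).Bad K t,
          |Real.log ((cr F θ hP g₀ os).B K 0 τ - (cr F θ hP g₀ os).shB K 0 τ) - Real.log ((cr F θ hP g₀ os).A K 0 τ - (cr F θ hP g₀ os).shA K 0 τ) - c| ≤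
            (cr F θ hP g₀ os).vol * δ₀ K) ∧
        (∀ K, ∀ τ ∈ (cr F θ hP g₀ os).T K, ∀ s ∈ Set.Icc (-(cr F θ hP g₀ os).l₀) (cr F θ hP g₀ os).l₀,
          HasDerivWithinAt (fun s => Real.log ((cr F θ hP g₀ os).A K s τ - (cr F θ hP g₀ os).shA K s τ)) (mA K s τ)
            (Set.Icc (-(cr F θ hP g₀ os).l₀) (cr F θ hP g₀ os).l₀) s) ∧
        (∀ K, ∀ τ ∈ (cr F θ hP g₀ os).T K, ∀ s ∈ Set.Icc (-(cr F θ hP g₀ os).l₀) (cr F θ hP g₀ os).l₀,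
          HasDerivWithinAt (fun s => Real.log ((cr F θ hP g₀ os).B K s τ - (cr F θ hP g₀ os).shB K s τ)) (mB K s τ)
            (Set.Icc (-(cr F θ hP g₀ os).l₀) (cr F θ hP g₀ os).l₀) s) ∧
        (∀ K (t : ℝ), |t| ≤ (cr F θ hP g₀ os).l₀ → ∀ τ ∈ (cr F θ hP g₀ os).T K \ (cr F θ hP g₀ os).Bad K t, ∀ s ∈ Set.uIcc (0 : ℝ) t,
          |mB K s τ - mA K s τ| ≤ Λ K)) :
    SpineGivenEndpointR12 :=
  spineGivenEndpointR12_of_forall_guarded_matchingUnder fun F θ hP hG hθ =>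
    matchingUnder_guarded_datumOfRecord₁₂_of_homes₁₂On cr 𝔯 (fun F θ => θ.ZtUnity F 2 ∧ θ.SlotsNondegenerate) h14 h15 h16 h17 h18 h22 h20 h21 hx
      (towerEdge₁₂On_of_insertionDerivReading cr 𝔯 (fun F θ => θ.ZtUnity F 2 ∧ θ.SlotsNondegenerate) hread) F θ hP hG hθ

end GuardHomes

/-! ## §3 (v1.2, append-only) The item from the stubs at the GUARD-restricted Stage-12 homes and a VACUUM-CORE ∕ MGF ∕ TILTED-MATCHING reading (module 15 by name) -/

section VacuumMGF

open MeasureTheory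
open T4OutputRate (Carriers Functional LipBackground NE5 NE9)
open T4TowerRateComposition (PolyLipGrowth)
open T4CauchySum (InjectedRate)
open T4EtaRateMin (Readings NE3Shape)
open T4RateLiaison (GaugeDominated)
open Summit.QuantumFields.BalabanUV.T4Continuum.NE1p.DressedMGFForm (MGFForm TiltedMeanMatching)
open Summit.QuantumFields.YangMills.BalabanUVNodes.N19LedgerLinkSync (LedgerDataSync)
open Summit.QuantumFields.YangMills.BalabanUVNodes.N19LedgerPieces (TwoRunFormat LedgerBooking LedgerOtherKinds LedgerSize LedgerConventions)
open Summit.QuantumFields.YangMills.BalabanUVNodes.N19TargetAtHomes12OnVacuumMGF (matchingUnder_guarded_datumOfRecord₁₂_of_homes₁₂On_vacuumMGF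
  matchingUnder_guarded_datumOfRecord₁₂_of_homes₁₂On_vacuumLedgerPiecesMGF)

variable (cr : SpineReading₁₂ 2) (𝔯 : RateReading₁₂ 2)

/-- **K3′ FROM THE STUBS AT THE GUARD-RESTRICTED STAGE-12 HOMES AND A VACUUM-CORE ∕ MGF ∕ TILTED-MATCHING READING** [bookkeeping] (`N = 2`, regime = the item's guard
`θ.ZtUnity F 2 ∧ θ.SlotsNondegenerate`; §2's `spineGivenEndpointR12_of_homes₁₂On_sourceSplit` with the source-split reading replaced): the six in-edges BY NAME at `RRec₁₂On 𝔯 Rg`,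
`S_N20` ∕ `S_N21` at `SRec₁₂On cr Rg`, the guarded keyed extraction clause, and — at every guarded admissible tuple, given the rates at every run length of `𝔯` — `0 < vol`, the VACUUM
shell-free cores' `NE7.Core` with summable `δ⁰`, MGF forms of both DRESSED shell-free cores, and N14's `TiltedMeanMatching η` with `Summable η` ⇒ `SpineGivenEndpointR12` (module 15
`matchingUnder_guarded_datumOfRecord₁₂_of_homes₁₂On_vacuumMGF` ∘ `spineGivenEndpointR12_of_forall_guarded_matchingUnder`).  Every input a HYPOTHESIS; (I) is N14's NE1′ residual, (V) any
N19 knit on the vacuum cores; NOT NE7; the item is NOT claimed. [folklore] -/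
theorem spineGivenEndpointR12_of_homes₁₂On_vacuumMGF
    (h14 : S_N14 (RRec₁₂On 𝔯 fun F θ => θ.ZtUnity F 2 ∧ θ.SlotsNondegenerate)) (h15 : S_N15 (RRec₁₂On 𝔯 fun F θ => θ.ZtUnity F 2 ∧ θ.SlotsNondegenerate))
    (h16 : S_N16 (RRec₁₂On 𝔯 fun F θ => θ.ZtUnity F 2 ∧ θ.SlotsNondegenerate)) (h17 : S_N17 (RRec₁₂On 𝔯 fun F θ => θ.ZtUnity F 2 ∧ θ.SlotsNondegenerate))
    (h18 : S_N18 (RRec₁₂On 𝔯 fun F θ => θ.ZtUnity F 2 ∧ θ.SlotsNondegenerate)) (h22 : S_N22 (RRec₁₂On 𝔯 fun F θ => θ.ZtUnity F 2 ∧ θ.SlotsNondegenerate))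
    (h20 : S_N20 (SRec₁₂On cr fun F θ => θ.ZtUnity F 2 ∧ θ.SlotsNondegenerate)) (h21 : S_N21 (SRec₁₂On cr fun F θ => θ.ZtUnity F 2 ∧ θ.SlotsNondegenerate))
    (hx : ∀ (F : T4Family) (θ : Stage12Params F 2) (hP : θ.Provisos₁₂ F 2), θ.ZtUnity F 2 ∧ θ.SlotsNondegenerate → θ.Admissible F 2 →
      B16.EndStatementBPrinted (datumOfRecord₁₂ F 2 θ hP).C → DagBinding.EndpointExistence (datumOfRecord₁₂ F 2 θ hP).C.toB12 →
        T4ContinuumYM4Torus.ForSmallCouplings (datumOfRecord₁₂ F 2 θ hP) fun g₀ => ∀ os : List (ULoop F),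
          0 < (cr F θ hP g₀ os).l₀ ∧ 0 < (cr F θ hP g₀ os).vol ∧
          (∀ (K : ℕ) (t : ℝ), |t| ≤ (cr F θ hP g₀ os).l₀ →
            T4GenFunBounds.schemeZ ((datumOfRecord₁₂ F 2 θ hP).scheme g₀) os ((cr F θ hP g₀ os).K₀ + K) t =
              ∑ τ ∈ (cr F θ hP g₀ os).T K, (cr F θ hP g₀ os).A K t τ) ∧
          (∀ (K : ℕ) (t : ℝ), |t| ≤ (cr F θ hP g₀ os).l₀ →
            T4GenFunBounds.schemeZ ((datumOfRecord₁₂ F 2 θ hP).scheme g₀) os ((cr F θ hP g₀ os).K₀ + K + 1) t =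
              ∑ τ ∈ (cr F θ hP g₀ os).T K, (cr F θ hP g₀ os).B K t τ))
    (hread : ∀ (F : T4Family) (θ : Stage12Params F 2) (hP : θ.Provisos₁₂ F 2), θ.ZtUnity F 2 ∧ θ.SlotsNondegenerate → θ.Admissible F 2 →
      ∀ (g₀ : ℕ → ℝ) (os : List (ULoop F)),
      (∀ k : ℕ, RatesAt (datumOfRecord₁₂ F 2 θ hP) (rateCarriersOfRecord₁₂ 𝔯 F θ hP g₀ os k)) → letI := (cr F θ hP g₀ os).dec
      0 < (cr F θ hP g₀ os).vol ∧
      ∃ (δ₀ η : ℕ → ℝ) (Ω Ω' : ℕ → Type) (_ : ∀ K, MeasurableSpace (Ω K)) (_ : ∀ K, MeasurableSpace (Ω' K)) (Bo : ℝ)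
        (Fo : ∀ K, Ω K → ℝ) (ν : ∀ K, (cr F θ hP g₀ os).ι → Measure (Ω K)) (Fo' : ∀ K, Ω' K → ℝ) (ν' : ∀ K, (cr F θ hP g₀ os).ι → Measure (Ω' K)),
        NE7.Core (cr F θ hP g₀ os).l₀ (cr F θ hP g₀ os).vol (cr F θ hP g₀ os).T (cr F θ hP g₀ os).Bad
          (fun K _ τ => (cr F θ hP g₀ os).A K 0 τ - (cr F θ hP g₀ os).shA K 0 τ) (fun K _ τ => (cr F θ hP g₀ os).B K 0 τ - (cr F θ hP g₀ os).shB K 0 τ) δ₀ ∧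
        Summable δ₀ ∧
        MGFForm Bo (cr F θ hP g₀ os).T Fo ν (fun K t τ => (cr F θ hP g₀ os).A K t τ - (cr F θ hP g₀ os).shA K t τ) ∧
        MGFForm Bo (cr F θ hP g₀ os).T Fo' ν' (fun K t τ => (cr F θ hP g₀ os).B K t τ - (cr F θ hP g₀ os).shB K t τ) ∧
        TiltedMeanMatching (cr F θ hP g₀ os).l₀ (cr F θ hP g₀ os).T (cr F θ hP g₀ os).Bad Fo ν Fo' ν' η ∧ Summable η) :
    SpineGivenEndpointR12 :=
  spineGivenEndpointR12_of_forall_guarded_matchingUnder fun F θ hP hG hθ =>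
    matchingUnder_guarded_datumOfRecord₁₂_of_homes₁₂On_vacuumMGF cr 𝔯 (fun F θ => θ.ZtUnity F 2 ∧ θ.SlotsNondegenerate)
      h14 h15 h16 h17 h18 h22 h20 h21 hx hread F θ hP hG hθ

/-- **K3′ FROM THE STUBS AT THE GUARD-RESTRICTED STAGE-12 HOMES AND NODE O's VACUUM LEDGER PIECES** [bookkeeping] (`N = 2`; the same with the vacuum `Core` PRODUCED by the
ledger road at the pieces of record): at every guarded admissible tuple, given the rates, `0 < vol` and ledger data `L`, readings `R` and letters with F1 `TwoRunFormat` · F2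
`LedgerBooking` · F3 `LedgerOtherKinds` · S `LedgerSize` · C `LedgerConventions` ON THE VACUUM shell-free cores of `cr F θ hP g₀ os`, the remaining kinds in SPECIES FORM (one-run
first-step bound, constants' deviation datum — F3′ no longer a hypothesis), the in-edge letters (N16 `NE3Shape` + `GaugeDominated`, N18 `NE5`, N22 `NE9 ∧ FadingMemory`, N17∕U2
`InjectedRate`, box, (T) `LipBackground` + `PolyLipGrowth`, window), MGF forms of both dressed shell-free cores and N14's `TiltedMeanMatching η` with `Summable η` ⇒
`SpineGivenEndpointR12` (module 15 `matchingUnder_guarded_datumOfRecord₁₂_of_homes₁₂On_vacuumLedgerPiecesMGF` ∘ `spineGivenEndpointR12_of_forall_guarded_matchingUnder`).  What NODE O's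
vacuum instance at the Stage-12 tuples must hand, BY NAME, with NO observable and NO unprinted estimate inside N19.  Every input a HYPOTHESIS; the item is NOT claimed. [folklore] -/
theorem spineGivenEndpointR12_of_homes₁₂On_vacuumLedgerPiecesMGF
    (h14 : S_N14 (RRec₁₂On 𝔯 fun F θ => θ.ZtUnity F 2 ∧ θ.SlotsNondegenerate)) (h15 : S_N15 (RRec₁₂On 𝔯 fun F θ => θ.ZtUnity F 2 ∧ θ.SlotsNondegenerate))
    (h16 : S_N16 (RRec₁₂On 𝔯 fun F θ => θ.ZtUnity F 2 ∧ θ.SlotsNondegenerate)) (h17 : S_N17 (RRec₁₂On 𝔯 fun F θ => θ.ZtUnity F 2 ∧ θ.SlotsNondegenerate))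
    (h18 : S_N18 (RRec₁₂On 𝔯 fun F θ => θ.ZtUnity F 2 ∧ θ.SlotsNondegenerate)) (h22 : S_N22 (RRec₁₂On 𝔯 fun F θ => θ.ZtUnity F 2 ∧ θ.SlotsNondegenerate))
    (h20 : S_N20 (SRec₁₂On cr fun F θ => θ.ZtUnity F 2 ∧ θ.SlotsNondegenerate)) (h21 : S_N21 (SRec₁₂On cr fun F θ => θ.ZtUnity F 2 ∧ θ.SlotsNondegenerate))
    (hx : ∀ (F : T4Family) (θ : Stage12Params F 2) (hP : θ.Provisos₁₂ F 2), θ.ZtUnity F 2 ∧ θ.SlotsNondegenerate → θ.Admissible F 2 →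
      B16.EndStatementBPrinted (datumOfRecord₁₂ F 2 θ hP).C → DagBinding.EndpointExistence (datumOfRecord₁₂ F 2 θ hP).C.toB12 →
        T4ContinuumYM4Torus.ForSmallCouplings (datumOfRecord₁₂ F 2 θ hP) fun g₀ => ∀ os : List (ULoop F),
          0 < (cr F θ hP g₀ os).l₀ ∧ 0 < (cr F θ hP g₀ os).vol ∧
          (∀ (K : ℕ) (t : ℝ), |t| ≤ (cr F θ hP g₀ os).l₀ →
            T4GenFunBounds.schemeZ ((datumOfRecord₁₂ F 2 θ hP).scheme g₀) os ((cr F θ hP g₀ os).K₀ + K) t =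
              ∑ τ ∈ (cr F θ hP g₀ os).T K, (cr F θ hP g₀ os).A K t τ) ∧
          (∀ (K : ℕ) (t : ℝ), |t| ≤ (cr F θ hP g₀ os).l₀ →
            T4GenFunBounds.schemeZ ((datumOfRecord₁₂ F 2 θ hP).scheme g₀) os ((cr F θ hP g₀ os).K₀ + K + 1) t =
              ∑ τ ∈ (cr F θ hP g₀ os).T K, (cr F θ hP g₀ os).B K t τ))
    (hread : ∀ (F : T4Family) (θ : Stage12Params F 2) (hP : θ.Provisos₁₂ F 2), θ.ZtUnity F 2 ∧ θ.SlotsNondegenerate → θ.Admissible F 2 →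
      ∀ (g₀ : ℕ → ℝ) (os : List (ULoop F)),
      (∀ k : ℕ, RatesAt (datumOfRecord₁₂ F 2 θ hP) (rateCarriersOfRecord₁₂ 𝔯 F θ hP g₀ os k)) → letI := (cr F θ hP g₀ os).dec
      0 < (cr F θ hP g₀ os).vol ∧
      ∃ (C : Carriers) (_ : DecidableEq C.Dom) (F' : Type) (ι' X' : Type) (_ : MeasurableSpace ι')
        (L : LedgerDataSync C F' ι' (cr F θ hP g₀ os).ι) (R : Readings ι' X') (W : Set (ℕ → ℝ)) (EA : Functional C C.BgA)
        (EB : Functional C C.BgB) (κ θ₅ C₅ C₉ ω θc Cd γ C₃ θ₃ Pg : ℝ) (q : ℕ) (Λm : ℕ → ℕ → ℝ)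
        (CU : (ℕ → ℝ) → ℕ → ℝ) (g : ℕ → ℕ → ℝ) (uA : ℕ → ι' → C.BgA) (uB : ℕ → ι' → C.BgB)
        (Φ : ℕ → ℝ → (cr F θ hP g₀ os).ι → ι' → ℝ) (e ρ : ℕ → ℝ) (α β : ℕ → ℝ → (cr F θ hP g₀ os).ι → ℝ)
        (η : ℕ → ℝ) (Ω Ω' : ℕ → Type) (_ : ∀ K, MeasurableSpace (Ω K)) (_ : ∀ K, MeasurableSpace (Ω' K)) (Bo : ℝ)
        (Fo : ∀ K, Ω K → ℝ) (ν : ∀ K, (cr F θ hP g₀ os).ι → Measure (Ω K)) (Fo' : ∀ K, Ω' K → ℝ) (ν' : ∀ K, (cr F θ hP g₀ os).ι → Measure (Ω' K)),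
        (TwoRunFormat L (cr F θ hP g₀ os).l₀ (cr F θ hP g₀ os).T (cr F θ hP g₀ os).Bad
            (fun K _ τ => (cr F θ hP g₀ os).A K 0 τ - (cr F θ hP g₀ os).shA K 0 τ) (fun K _ τ => (cr F θ hP g₀ os).B K 0 τ - (cr F θ hP g₀ os).shB K 0 τ) R EA EB g uA uB ∧
          LedgerBooking L (cr F θ hP g₀ os).l₀ (cr F θ hP g₀ os).vol (cr F θ hP g₀ os).T (cr F θ hP g₀ os).Bad κ ∧
          LedgerOtherKinds L (cr F θ hP g₀ os).l₀ (cr F θ hP g₀ os).vol (cr F θ hP g₀ os).T (cr F θ hP g₀ os).Bad R EA EB g ∧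
          LedgerSize L (cr F θ hP g₀ os).l₀ (cr F θ hP g₀ os).vol (cr F θ hP g₀ os).T (cr F θ hP g₀ os).Bad R EA EB g uA uB ∧
          LedgerConventions L (cr F θ hP g₀ os).vol R ω θc θ₅ θ₃) ∧
        ((∀ K t τ v, L.oA'' K t τ v = Real.exp (α K t τ)) ∧
          (∀ K t τ v, L.oB'' K t τ v = Real.exp (Φ K t τ v + e K) * Real.exp (β K t τ)) ∧
          (∀ K t τ, L.cO'' K t τ = e K + (β K t τ - α K t τ)) ∧ (∀ K t τ, L.RO'' K t τ = (cr F θ hP g₀ os).vol * ρ K) ∧ L.rO'' = ρ ∧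
          (∀ K t, |t| ≤ (cr F θ hP g₀ os).l₀ → ∀ τ ∈ (cr F θ hP g₀ os).T K \ (cr F θ hP g₀ os).Bad K t, ∀ v ∈ R.dom,
            |Φ K t τ v| ≤ (cr F θ hP g₀ os).vol * ρ K) ∧ Summable ρ ∧
          (∃ b₀ s : ℕ → ℝ, Summable s ∧ ∀ K t, |t| ≤ (cr F θ hP g₀ os).l₀ → ∀ τ ∈ (cr F θ hP g₀ os).T K \ (cr F θ hP g₀ os).Bad K t,
            |β K t τ - α K t τ - b₀ K| ≤ (cr F θ hP g₀ os).vol * s K)) ∧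
        (NE3Shape R C₃ θ₃ ∧ 0 ≤ C₃ ∧ GaugeDominated R uA uB ∧
          NE5 EA EB W κ θ₅ C₅ ∧ 0 ≤ θ₅ ∧ 0 ≤ C₅ ∧
          (NE9 EA W κ Λm ∧ T4OutputRate.FadingMemory C₉ ω Λm) ∧ 0 ≤ ω ∧
          InjectedRate Cd 0 θc (fun K j => T4CouplingMatching.disc (g K) (g (K + 1)) j) ∧ 0 ≤ Cd ∧ 0 ≤ θc ∧
          (∀ K i, i ≤ K → 0 < g K i ∧ g K i ≤ γ) ∧
          LipBackground EA W κ CU ∧ PolyLipGrowth CU g Pg q ∧ 0 ≤ Pg ∧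
          (∀ K, g K ∈ W) ∧ (∀ K, (fun i => g (K + 1) (i + 1)) ∈ W)) ∧
        (MGFForm Bo (cr F θ hP g₀ os).T Fo ν (fun K t τ => (cr F θ hP g₀ os).A K t τ - (cr F θ hP g₀ os).shA K t τ) ∧
          MGFForm Bo (cr F θ hP g₀ os).T Fo' ν' (fun K t τ => (cr F θ hP g₀ os).B K t τ - (cr F θ hP g₀ os).shB K t τ) ∧
          TiltedMeanMatching (cr F θ hP g₀ os).l₀ (cr F θ hP g₀ os).T (cr F θ hP g₀ os).Bad Fo ν Fo' ν' η ∧ Summable η)) :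
    SpineGivenEndpointR12 :=
  spineGivenEndpointR12_of_forall_guarded_matchingUnder fun F θ hP hG hθ =>
    matchingUnder_guarded_datumOfRecord₁₂_of_homes₁₂On_vacuumLedgerPiecesMGF cr 𝔯 (fun F θ => θ.ZtUnity F 2 ∧ θ.SlotsNondegenerate)
      h14 h15 h16 h17 h18 h22 h20 h21 hx hread F θ hP hG hθ

end VacuumMGF

end Summit.QuantumFields.YangMills.BalabanUVNodes.N19TargetK3R12Reading
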